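import Summits.AtomisticToContinuum.HydrodynamicLimit.Theorems.StiffCollisionalRelaxationAprioriBoundsEquilibriumStatics
import Literature.Analysis.FluidPDE.ReleaseLogBoundDatum
import Literature.Analysis.FluidPDE.HardSphereTorusMeasure
import Mathlib.Analysis.SpecialFunctions.Pow.Asymptotics
import HarnessLib

/-!
# The floor at homogeneous data: no mesoscopic cell is empty, along every hard-sphere flow

Supporting file of the line `Sketch` for the crux `AprioriBounds` (stmt-AtomisticToContinuum-14827;
`Summit.AtomisticToContinuum.HydrodynamicLimit.Theses.StiffCollisionalRelaxation.AprioriBounds`), lead prover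
`prover-line-stmt-AtomisticToContinuum-14827-c2-0`.  It serves the registered stub `stub_floorFixed` (the
fixed-`(s, x)` mesoscopic FLOOR bound of component (ii) of the crux, "no mesoscopic cell is ever empty") by
delivering its EQUILIBRIUM INSTANCE: at the homogeneous local Gibbs data `(a₀, u₀, θ₀) = (1, 0, θ₀)`, for EVERY
family of hard-sphere flows `Φ_N`, every `N`, every time `s` and every block centre `x`,

  `P_N {z | ρ̄_N(Φ_s z, x) < c₁} ≤ δ_N`,  `(N+1)² δ_N → 0`,  `c₁ > 0` independent of `N`,

where `ρ̄_N(w, x) = (N+1)⁻¹ ∑ᵢ φ_N(xᵢ(w) − x)` is the block density of an admissible kernel `φ_N` (smooth,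
`0 ≤ φ_N`, `∫φ_N = 1`, supported in the minimal-image ball of radius `(N+1)^{-γ}`, `‖∇φ_N‖ ≤ C(N+1)^{4γ}`,
`0 < γ < 1/3`), GIVEN the static lower tail of the ball occupation numbers of the canonical hard-sphere gas as
the hypothesis `hstat` (interface `H-low`, proved by the lead in the sibling floor-statics file and discharged
at assembly).

Proof (`floorFixed_homogeneous_of_static`; quantifier form `floorFixed_homogeneous_of_hLow`, the sub-goal
registered on the crux item for this file):
* KERNEL GEOMETRY (`floorHom_exists_peak`, first-moment method): `∫φ_N = 1` on a ball of Haar volume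
  `≤ (4/3)π(N+1)^{-3γ}`, so `φ_N(y₀) ≥ 2m_N`, `m_N = 3(N+1)^{3γ}/(16π)`, at some `y₀`;
* MEAN VALUE (`floorHom_ball_lower`, torus mean-value inequality `Torus.abs_sub_le_of_norm_gradient_le` and
  `‖x − y‖_∞ ≤ dist(x, y)`): `φ_N ≥ m_N` on the minimal-image ball `B(y₀, r_N)`, `r_N = κ(N+1)^{-γ}`,
  `κ = 3/(16π(√3 C + 1))`;
* COUNT DOMINATION (`floorHom_indicator_le`): `∑ᵢ φ_N(xᵢ − x) ≥ m_N #{i | xᵢ ∈ B(x + y₀, r_N)}`, so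
  `{ρ̄ < c₁} ⊆ {# ≤ (N+1)|B|/16}` for `c₁ = κ³/64`;
* TRANSFER: the homogeneous law `P_N = localGibbsMeasure σ 1 0 θ₀ N` (`localGibbsLaw_eq`) is invariant under
  every `Φ_s` (`flow_invariance_homogeneous`), the event is positional and the position marginal is the canonical
  gas (`localGibbsMeasure_preimage_pos`), whose lower tail is `hstat`:
  `≤ 8 exp(−(log 2/16)(4/3)πκ³ (N+1)^{1−3γ})` once `2ε_N ≤ r_N < 1/4` (all large `N`; small `N` are absorbed
  in `δ_N` since `P_N` is a probability measure); `(N+1)² e^{−b(N+1)^{1−3γ}} → 0` (`floorHom_tendsto`).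

No new definitions, no named facts; axioms `propext`, `Classical.choice`, `Quot.sound`.
-/

noncomputable section

open MeasureTheory Filter Set Topology
open scoped ENNReal

namespace Summit.AtomisticToContinuum.HydrodynamicLimit.Theorems.AdiabatCeiling

open Literature.MathematicalPhysics.KineticTheory Literature.Analysis.FluidPDE

/-! ## §1 Real-variable and metric preliminaries -/

/-- **The floor rate beats squares**: `(N+1)² · 8 exp(−b (N+1)^{1−3γ}) → 0` for `γ < 1/3`, `b > 0`
(`tendsto_rpow_mul_exp_neg_mul_atTop_nhds_zero` with exponent `2/(1−3γ)` along `u_N = (N+1)^{1−3γ} → ∞`). -/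
theorem floorHom_tendsto {γ b : ℝ} (hγ1 : γ < 1 / 3) (hb : 0 < b) :
    Tendsto (fun N : ℕ => ((N : ℝ) + 1) ^ 2 * (8 * Real.exp (-(b * ((N : ℝ) + 1) ^ (1 - 3 * γ)))))
      atTop (𝓝 0) := by
  have ha : 0 < 1 - 3 * γ := by linarith
  have h1 : Tendsto (fun N : ℕ => (N : ℝ) + 1) atTop atTop :=
    tendsto_atTop_add_const_right _ 1 tendsto_natCast_atTop_atTop
  have hu : Tendsto (fun N : ℕ => ((N : ℝ) + 1) ^ (1 - 3 * γ)) atTop atTop :=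
    (tendsto_rpow_atTop ha).comp h1
  have h := ((tendsto_rpow_mul_exp_neg_mul_atTop_nhds_zero (2 / (1 - 3 * γ)) b hb).comp hu).const_mul 8
  rw [mul_zero] at h
  refine h.congr fun N => ?_
  have hn : (0 : ℝ) ≤ (N : ℝ) + 1 := by positivity
  have h2 : (1 - 3 * γ) * (2 / (1 - 3 * γ)) = 2 := by field_simp
  simp only [Function.comp_apply]
  rw [← Real.rpow_mul hn, h2, Real.rpow_two, neg_mul]
  ring

/-- **The sup-norm of `𝕋³ = (ℝ/ℤ)³` is dominated by the minimal-image Euclidean distance**: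
`‖x − y‖ ≤ dist(x, y)` (coordinatewise, `norm_apply_sub_le_euclidDist`). -/
theorem floorHom_norm_sub_le_euclidDist (x y : T3) : ‖x - y‖ ≤ Torus.euclidDist x y :=
  (pi_norm_le_iff_of_nonneg (by rw [Torus.euclidDist_eq]; exact norm_nonneg _)).2
    fun i => norm_apply_sub_le_euclidDist x y i

/-! ## §2 Kernel geometry: a peak, a ball below the kernel, count domination -/

/-- **First-moment method for a normalised kernel**: if `0 ≤ φ`, `∫φ = 1` and `φ` vanishes off the
minimal-image ball `{dist(y, 0) < ρ}` (`ρ > 0`), then `φ(y₀) ≥ 2 · 3/(16πρ³)` at some point `y₀`: otherwise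
`1 = ∫_{ball} φ ≤ (3/(8πρ³)) vol(ball) ≤ (3/(8πρ³)) (4/3)πρ³ = 1/2` (the Haar volume of a minimal-image ball
is at most the Euclidean one, `Torus.volume_reprSym_sub_mem`, `EuclideanSpace.volume_ball_fin_three`). -/
theorem floorHom_exists_peak {φ : T3 → ℝ} {ρ : ℝ} (hρ : 0 < ρ) (hφ0 : ∀ y, 0 ≤ φ y)
    (hφ1 : ∫ y, φ y = 1) (hsupp : ∀ y, ρ ≤ Torus.euclidDist y 0 → φ y = 0) :
    ∃ y₀, 2 * (3 / (16 * Real.pi * ρ ^ 3)) ≤ φ y₀ := by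
  by_contra h
  push Not at h
  obtain ⟨B, hB⟩ : ∃ B : Set T3, B = {y | Torus.euclidDist y 0 < ρ} := ⟨_, rfl⟩
  -- `∫ φ = ∫_B φ = 1`
  have h1 : ∫ y in B, φ y = 1 := by
    rw [setIntegral_eq_integral_of_forall_compl_eq_zero, hφ1]
    intro y hy
    rw [hB, Set.mem_setOf_eq, not_lt] at hy
    exact hsupp y hy
  -- the Haar volume of the minimal-image ball is at most `(4/3)πρ³`
  have hvol : volume B ≤ ENNReal.ofReal ρ ^ 3 * ENNReal.ofReal (Real.pi * 4 / 3) := by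
    rw [← EuclideanSpace.volume_ball_fin_three 0 ρ]
    have hBeq : B = {y : T3 | Torus.reprSym (y - 0) ∈ Metric.ball (0 : EuclideanSpace ℝ (Fin 3)) ρ} := by
      ext y
      simp only [hB, Set.mem_setOf_eq, Torus.euclidDist_eq, mem_ball_zero_iff]
    rw [hBeq, Torus.volume_reprSym_sub_mem (0 : T3)
      (measurableSet_ball (x := (0 : EuclideanSpace ℝ (Fin 3))) (ε := ρ))]
    exact measure_mono inter_subset_left
  have hvol' : volume.real B ≤ ρ ^ 3 * (Real.pi * 4 / 3) := by
    have h2 := ENNReal.toReal_mono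
      (ENNReal.mul_ne_top (ENNReal.pow_ne_top ENNReal.ofReal_ne_top) ENNReal.ofReal_ne_top) hvol
    rwa [ENNReal.toReal_mul, ENNReal.toReal_pow, ENNReal.toReal_ofReal hρ.le,
      ENNReal.toReal_ofReal (by positivity)] at h2
  -- the bound on the integral
  have h3 : ‖∫ y in B, φ y‖ ≤ 2 * (3 / (16 * Real.pi * ρ ^ 3)) * volume.real B :=
    norm_setIntegral_le_of_norm_le_const (measure_lt_top _ _) fun y _ => by
      rw [Real.norm_eq_abs, abs_of_nonneg (hφ0 y)]
      exact (h y).le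
  rw [h1, norm_one] at h3
  have h4 : 2 * (3 / (16 * Real.pi * ρ ^ 3)) * (ρ ^ 3 * (Real.pi * 4 / 3)) = 1 / 2 := by
    field_simp
    ring
  have h5 : (1 : ℝ) ≤ 1 / 2 :=
    h4 ▸ h3.trans (mul_le_mul_of_nonneg_left hvol' (by positivity))
  linarith

/-- **A ball below the kernel** (mean-value step): if `φ` is smooth with `‖∇φ‖ ≤ L`, `φ(y₀) ≥ 2m` and
`√3 · L · r ≤ m`, then `φ ≥ m` on the minimal-image ball `{dist(y, y₀) < r}`
(`Torus.abs_sub_le_of_norm_gradient_le` and `‖y − y₀‖ ≤ dist(y, y₀)`). -/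
theorem floorHom_ball_lower {φ : T3 → ℝ} (hs : Literature.Analysis.FunctionSpaces.Torus.IsSmooth φ)
    {L m r : ℝ} (hL : ∀ y, ‖Literature.Analysis.FunctionSpaces.Torus.gradient φ y‖ ≤ L) {y₀ : T3}
    (hy₀ : 2 * m ≤ φ y₀) (hr : Real.sqrt 3 * L * r ≤ m) {y : T3} (hy : Torus.euclidDist y y₀ < r) :
    m ≤ φ y := by
  have hL0 : 0 ≤ L := (norm_nonneg _).trans (hL y₀)
  have h1 := Torus.abs_sub_le_of_norm_gradient_le hs hL y y₀
  simp only [Fintype.card_fin, Nat.cast_ofNat] at h1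
  have h2 : Real.sqrt 3 * L * ‖y - y₀‖ ≤ Real.sqrt 3 * L * r :=
    mul_le_mul_of_nonneg_left ((floorHom_norm_sub_le_euclidDist y y₀).trans hy.le) (by positivity)
  have h3 := (abs_le.1 (h1.trans h2)).1
  linarith

/-- **Count domination, one particle**: if `0 ≤ g` and `g ≥ m` on the minimal-image ball `B(c, r)`,
then `m · 𝟙_{B(c,r)}(a) ≤ g(a)`. -/
theorem floorHom_indicator_le {g : T3 → ℝ} {c : T3} {r m : ℝ} (hg0 : ∀ a, 0 ≤ g a)
    (hball : ∀ a, Torus.euclidDist a c < r → m ≤ g a) (a : T3) :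
    m * ({y : T3 | Torus.euclidDist y c < r}).indicator (fun _ => (1 : ℝ)) a ≤ g a := by
  by_cases ha : Torus.euclidDist a c < r
  · rw [Set.indicator_of_mem (show a ∈ {y : T3 | Torus.euclidDist y c < r} from ha), mul_one]
    exact hball a ha
  · rw [Set.indicator_of_notMem (show a ∉ {y : T3 | Torus.euclidDist y c < r} from ha), mul_zero]
    exact hg0 a

/-! ## §3 The fixed-point floor bound at homogeneous data, from the static lower tail -/

/-- **The floor at homogeneous data, for every flow, from the static bound** (equilibrium instance of the
fixed-`(s, x)` mesoscopic floor bound `stub_floorFixed`).  Let `σ ≤ 1/2`, `θ₀ > 0`, and assume the static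
lower tail `hstat` of the ball occupation numbers of the canonical gas `posGibbsMeasure 1 ε_N (N+1)` (interface
`H-low`: `P{#{i | xᵢ ∈ B(c, r)} ≤ (N+1)|B_r|/16} ≤ 8 exp(−(log 2/16)(N+1)|B_r|)` for `2ε_N ≤ r < 1/4`).  Then for
every family of hard-sphere flows `Φ_N` and every admissible kernel family `φ_N` (`0 < γ < 1/3`) there are
`c₁ > 0` and a rate `δ_N` with `(N+1)² δ_N → 0` such that for all `N`, all times `s` and all centres `x`,
`localGibbsLaw σ 1 0 θ₀ N Φ_N {z | ρ̄_N(Φ_s z, x) < c₁} ≤ δ_N`.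
Constants: `κ = 3/(16π(√3 C + 1))`, `c₁ = κ³/64`,
`δ_N = 8 exp(−(log 2/16)(4/3)πκ³ (N+1)^{1−3γ}) + 𝟙{N < N₀}`. -/
theorem floorFixed_homogeneous_of_static {σ θ₀ : ℝ} (hσ2 : σ ≤ 1 / 2) (hθ : 0 < θ₀)
    (hstat : ∀ (N : ℕ) (c : T3) (r : ℝ), 2 * hsDiameter σ N ≤ r → r < 1 / 4 →
      posGibbsMeasure (fun _ => (1 : ℝ)) (hsDiameter σ N) (N + 1)
          {x | (∑ i, ({y : T3 | Torus.euclidDist y c < r}).indicator (fun _ => (1 : ℝ)) (x i)) ≤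
              ((N : ℝ) + 1) * (4 / 3 * Real.pi * r ^ 3) / 16} ≤
        ENNReal.ofReal (8 * Real.exp (-(Real.log 2 / 16 * (((N : ℝ) + 1) * (4 / 3 * Real.pi * r ^ 3))))))
    (Φ : (N : ℕ) → HardSphereFlow (Torus.geometry (Fin 3)) (hsDiameter σ N) (N + 1))
    {γ C : ℝ} {φ : ℕ → T3 → ℝ} (hγ : 0 < γ) (hγ1 : γ < 1 / 3)
    (hadm : (∀ N, Literature.Analysis.FunctionSpaces.Torus.IsSmooth (φ N)) ∧ (∀ N y, 0 ≤ φ N y) ∧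
      (∀ N, ∫ y, φ N y = 1) ∧
      (∀ (N : ℕ) y, ((N : ℝ) + 1) ^ (-γ) ≤ Torus.euclidDist y 0 → φ N y = 0) ∧
      (∀ (N : ℕ) y, φ N y ≤ C * ((N : ℝ) + 1) ^ (3 * γ)) ∧
      (∀ (N : ℕ) y, ‖Literature.Analysis.FunctionSpaces.Torus.gradient (φ N) y‖ ≤
        C * ((N : ℝ) + 1) ^ (4 * γ))) :
    ∃ c₁ : ℝ, 0 < c₁ ∧ ∃ δ : ℕ → ℝ, Tendsto (fun N : ℕ => ((N : ℝ) + 1) ^ 2 * δ N) atTop (𝓝 0) ∧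
      ∀ (N : ℕ) (s : ℝ) (x : T3),
        localGibbsLaw σ (fun _ => 1) (fun _ => 0) (fun _ => θ₀) N (Φ N)
            {z | empiricalDensityField ((Φ N).flow s z) (fun y => φ N (y - x)) < c₁} ≤
          ENNReal.ofReal (δ N) := by
  obtain ⟨hsm, hφ0, hφ1, hsupp, -, hgrad⟩ := hadm
  -- `C ≥ 0` (the gradient bound at `N = 0`), the constants `κ, b > 0`
  have hC : 0 ≤ C := by
    have h1 := hgrad 0 0
    simp only [Nat.cast_zero, zero_add, Real.one_rpow, mul_one] at h1
    exact (norm_nonneg _).trans h1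
  obtain ⟨κ, hκ⟩ : ∃ κ : ℝ, κ = 3 / (16 * Real.pi * (Real.sqrt 3 * C + 1)) := ⟨_, rfl⟩
  have hκ0 : 0 < κ := by
    rw [hκ]
    positivity
  have hκu : κ * (Real.sqrt 3 * C + 1) = 3 / (16 * Real.pi) := by
    rw [hκ]
    field_simp
  have hsC : Real.sqrt 3 * C * κ ≤ 3 / (16 * Real.pi) := by
    have e : Real.sqrt 3 * C * κ = κ * (Real.sqrt 3 * C + 1) - κ := by ring
    rw [e, hκu]
    linarith
  obtain ⟨b, hb⟩ : ∃ b : ℝ, b = Real.log 2 / 16 * (4 / 3 * Real.pi * κ ^ 3) := ⟨_, rfl⟩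
  have hb0 : 0 < b := by
    rw [hb]
    have := Real.log_pos (one_lt_two : (1 : ℝ) < 2)
    positivity
  -- the threshold `N₀`: `κ (N+1)^{-γ} < 1/4` and `2σ (N+1)^{-(1/3-γ)} < κ` for `N ≥ N₀`
  have hT : Tendsto (fun N : ℕ => (N : ℝ) + 1) atTop atTop :=
    tendsto_atTop_add_const_right _ 1 tendsto_natCast_atTop_atTop
  have hρT : Tendsto (fun N : ℕ => κ * ((N : ℝ) + 1) ^ (-γ)) atTop (𝓝 0) := by
    have h := ((tendsto_rpow_neg_atTop hγ).comp hT).const_mul κ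
    rw [mul_zero] at h
    exact h
  have hεT : Tendsto (fun N : ℕ => 2 * σ * ((N : ℝ) + 1) ^ (-(1 / 3 - γ))) atTop (𝓝 0) := by
    have h := ((tendsto_rpow_neg_atTop (by linarith : (0 : ℝ) < 1 / 3 - γ)).comp hT).const_mul (2 * σ)
    rw [mul_zero] at h
    exact h
  obtain ⟨N₀, hN₀⟩ := Filter.eventually_atTop.1
    (((tendsto_order.1 hρT).2 (1 / 4) (by norm_num)).and ((tendsto_order.1 hεT).2 κ hκ0))
  obtain ⟨δ, hδ⟩ : ∃ δ : ℕ → ℝ, δ = fun N : ℕ =>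
      8 * Real.exp (-(b * ((N : ℝ) + 1) ^ (1 - 3 * γ))) + (if N₀ ≤ N then 0 else 1) := ⟨_, rfl⟩
  refine ⟨κ ^ 3 / 64, by positivity, δ, ?_, fun N s x => ?_⟩
  · -- the rate: `(N+1)² δ_N → 0`
    have hA := floorHom_tendsto hγ1 hb0
    have hB : Tendsto (fun N : ℕ => ((N : ℝ) + 1) ^ 2 * (if N₀ ≤ N then (0 : ℝ) else 1)) atTop (𝓝 0) := by
      refine tendsto_const_nhds.congr' ?_
      filter_upwards [Filter.eventually_ge_atTop N₀] with N hN
      rw [if_pos hN, mul_zero]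
    have h := hA.add hB
    rw [add_zero] at h
    refine h.congr fun N => ?_
    simp only [hδ, mul_add]
  -- the bound at `(N, s, x)`
  have hn : (0 : ℝ) < (N : ℝ) + 1 := by positivity
  have hexp0 : 0 < 8 * Real.exp (-(b * ((N : ℝ) + 1) ^ (1 - 3 * γ))) := by positivity
  rcases lt_or_ge N N₀ with hlt | hge
  · -- small `N`: the law is a probability measure and `δ_N ≥ 1`
    haveI := isProbabilityMeasure_localGibbsLaw (a₀ := fun _ => (1 : ℝ)) (θ₀ := fun _ => θ₀)
      (u₀ := fun _ => (0 : V3)) continuous_const continuous_const continuous_const (fun _ => one_pos)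
      (fun _ => hθ) hσ2 N (Φ N)
    refine prob_le_one.trans ?_
    rw [ENNReal.one_le_ofReal, hδ]
    simp only [if_neg (not_le.2 hlt)]
    linarith
  obtain ⟨hr4, hεκ⟩ := hN₀ N hge
  have hδN : δ N = 8 * Real.exp (-(b * ((N : ℝ) + 1) ^ (1 - 3 * γ))) := by
    rw [hδ]
    simp only [if_pos hge, add_zero]
  rw [hδN]
  -- the radii `ρ = (N+1)^{-γ}` (kernel support) and `κρ` (the ball below the kernel), the level `m`
  set ρ : ℝ := ((N : ℝ) + 1) ^ (-γ) with hρdef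
  have hρ0 : 0 < ρ := Real.rpow_pos_of_pos hn _
  have hA4 : ((N : ℝ) + 1) ^ (4 * γ) * ρ ^ 4 = 1 := by
    rw [hρdef, ← Real.rpow_natCast _ 4, ← Real.rpow_mul hn.le, ← Real.rpow_add hn]
    rw [show 4 * γ + -γ * ((4 : ℕ) : ℝ) = 0 by push_cast; ring, Real.rpow_zero]
  have hA3 : ((N : ℝ) + 1) * ρ ^ 3 = ((N : ℝ) + 1) ^ (1 - 3 * γ) := by
    rw [hρdef, ← Real.rpow_natCast _ 3, ← Real.rpow_mul hn.le, sub_eq_add_neg, Real.rpow_add hn,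
      Real.rpow_one]
    rw [show -γ * ((3 : ℕ) : ℝ) = -(3 * γ) by push_cast; ring]
  have h2ε : 2 * hsDiameter σ N ≤ κ * ρ := by
    have e1 : ((N : ℝ) + 1) ^ (-(1 / 3 : ℝ)) = ((N : ℝ) + 1) ^ (-(1 / 3 - γ)) * ρ := by
      rw [hρdef, ← Real.rpow_add hn]
      congr 1
      ring
    have e2 : hsDiameter σ N = σ * (((N : ℝ) + 1) ^ (-(1 / 3 - γ)) * ρ) := by
      rw [hsDiameter, ← e1]
      push_cast
      ring
    rw [e2]
    calc 2 * (σ * (((N : ℝ) + 1) ^ (-(1 / 3 - γ)) * ρ))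
        = (2 * σ * ((N : ℝ) + 1) ^ (-(1 / 3 - γ))) * ρ := by ring
      _ ≤ κ * ρ := mul_le_mul_of_nonneg_right hεκ.le hρ0.le
  have hrate : Real.log 2 / 16 * (((N : ℝ) + 1) * (4 / 3 * Real.pi * (κ * ρ) ^ 3)) =
      b * ((N : ℝ) + 1) ^ (1 - 3 * γ) := by
    rw [hb, ← hA3]
    ring
  set m : ℝ := 3 / (16 * Real.pi * ρ ^ 3) with hmdef
  have hm0 : 0 < m := by positivity
  have hLr : Real.sqrt 3 * (C * ((N : ℝ) + 1) ^ (4 * γ)) * (κ * ρ) ≤ m := by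
    rw [hmdef, le_div_iff₀ (by positivity)]
    calc Real.sqrt 3 * (C * ((N : ℝ) + 1) ^ (4 * γ)) * (κ * ρ) * (16 * Real.pi * ρ ^ 3)
        = 16 * Real.pi * (Real.sqrt 3 * C * κ) * (((N : ℝ) + 1) ^ (4 * γ) * ρ ^ 4) := by ring
      _ = 16 * Real.pi * (Real.sqrt 3 * C * κ) := by rw [hA4, mul_one]
      _ ≤ 16 * Real.pi * (3 / (16 * Real.pi)) := mul_le_mul_of_nonneg_left hsC (by positivity)
      _ = 3 := by field_simp
  have hmV : κ ^ 3 / 64 * ((N : ℝ) + 1) = m * (((N : ℝ) + 1) * (4 / 3 * Real.pi * (κ * ρ) ^ 3) / 16) := by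
    rw [hmdef]
    field_simp
    ring
  -- the peak `y₀` of `φ_N` and the ball `B(x + y₀, κρ)` on which `g = φ_N(· - x) ≥ m`
  obtain ⟨y₀, hy₀⟩ := floorHom_exists_peak hρ0 (hφ0 N) (hφ1 N) (hsupp N)
  set g : T3 → ℝ := fun y => φ N (y - x) with hg
  have hg0 : ∀ a, 0 ≤ g a := fun a => hφ0 N _
  have hball : ∀ a, Torus.euclidDist a (x + y₀) < κ * ρ → m ≤ g a := by
    intro a ha
    refine floorHom_ball_lower (hsm N) (hgrad N) hy₀ hLr ?_
    rwa [Torus.euclidDist_eq, sub_sub, ← Torus.euclidDist_eq]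
  -- the positional sub-level event of `hstat` and its measurability
  obtain ⟨S, hS⟩ : ∃ S : Set (Fin (N + 1) → T3),
      S = {p | (∑ i, ({y : T3 | Torus.euclidDist y (x + y₀) < κ * ρ}).indicator (fun _ => (1 : ℝ)) (p i)) ≤
        ((N : ℝ) + 1) * (4 / 3 * Real.pi * (κ * ρ) ^ 3) / 16} := ⟨_, rfl⟩
  have hBm : MeasurableSet {y : T3 | Torus.euclidDist y (x + y₀) < κ * ρ} :=
    measurableSet_lt (Torus.continuous_euclidDist.comp (continuous_id.prodMk continuous_const)).measurable
      measurable_const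
  have hSm : MeasurableSet S := by
    rw [hS]
    exact measurableSet_le (Finset.measurable_sum _ fun i _ =>
      (measurable_const.indicator hBm).comp (measurable_pi_apply i)) measurable_const
  -- `{ρ̄(Φ_s z, x) < c₁} ⊆ Φ_s⁻¹ (pos⁻¹ S)` by count domination
  have hsub : {z : Config (N + 1) (Fin 3) T3 | empiricalDensityField ((Φ N).flow s z) g < κ ^ 3 / 64} ⊆
      (Φ N).flow s ⁻¹' ((fun (z : Config (N + 1) (Fin 3) T3) (i : Fin (N + 1)) => (z i).1) ⁻¹' S) := by
    intro z hz
    rw [Set.mem_setOf_eq, empiricalDensityField_eq_sum] at hz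
    push_cast at hz
    rw [inv_mul_eq_div, div_lt_iff₀ hn] at hz
    rw [Set.mem_preimage, Set.mem_preimage, hS, Set.mem_setOf_eq]
    have hdom : m * ∑ i, ({y : T3 | Torus.euclidDist y (x + y₀) < κ * ρ}).indicator (fun _ => (1 : ℝ))
          (((Φ N).flow s z i).1) ≤ ∑ i, g (((Φ N).flow s z i).1) := by
      rw [Finset.mul_sum]
      exact Finset.sum_le_sum fun i _ => floorHom_indicator_le hg0 hball _
    have h3 := hdom.trans_lt hz
    rw [hmV] at h3
    exact (lt_of_mul_lt_mul_left h3 hm0.le).le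
  -- invariance removes the flow, the position marginal is the canonical gas, then `hstat`
  rw [localGibbsLaw_eq]
  have hinv := flow_invariance_homogeneous σ θ₀ N (Φ N) s
  have hmarg : localGibbsMeasure σ (fun _ => 1) (fun _ => 0) (fun _ => θ₀) N
        ((fun (z : Config (N + 1) (Fin 3) T3) (i : Fin (N + 1)) => (z i).1) ⁻¹' S) =
      posGibbsMeasure (fun _ => (1 : ℝ)) (hsDiameter σ N) (N + 1) S :=
    localGibbsMeasure_preimage_pos (a₀ := fun _ => (1 : ℝ)) (θ₀ := fun _ => θ₀) (u₀ := fun _ => (0 : V3))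
      continuous_const continuous_const continuous_const (fun _ => zero_le_one) (fun _ => hθ) σ N hSm
  have hstatN := hstat N (x + y₀) (κ * ρ) h2ε hr4
  rw [← hS, hrate] at hstatN
  calc localGibbsMeasure σ (fun _ => 1) (fun _ => 0) (fun _ => θ₀) N
        {z | empiricalDensityField ((Φ N).flow s z) g < κ ^ 3 / 64}
      ≤ localGibbsMeasure σ (fun _ => 1) (fun _ => 0) (fun _ => θ₀) N
          ((Φ N).flow s ⁻¹' ((fun (z : Config (N + 1) (Fin 3) T3) (i : Fin (N + 1)) => (z i).1) ⁻¹' S)) :=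
        measure_mono hsub
    _ ≤ localGibbsMeasure σ (fun _ => 1) (fun _ => 0) (fun _ => θ₀) N
          ((fun (z : Config (N + 1) (Fin 3) T3) (i : Fin (N + 1)) => (z i).1) ⁻¹' S) :=
        hinv.measure_preimage_le _
    _ = posGibbsMeasure (fun _ => (1 : ℝ)) (hsDiameter σ N) (N + 1) S := hmarg
    _ ≤ ENNReal.ofReal (8 * Real.exp (-(b * ((N : ℝ) + 1) ^ (1 - 3 * γ)))) := hstatN

/-- **The floor at homogeneous data, quantifier form** (the sub-goal registered on the crux item for this file,
consumed by the lead's assembly of the equilibrium rung of (ii)): for all `σ, θ₀` with `σ ≤ 1/2`, `0 < θ₀`, the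
static lower tail `H-low` of the ball occupation numbers for `σ` implies, for every family of hard-sphere flows
and every admissible kernel family (`0 < γ < 1/3`), constants `c₁ > 0` and a rate `δ_N` with `(N+1)² δ_N → 0`
and `localGibbsLaw σ 1 0 θ₀ N Φ_N {ρ̄_N(Φ_s z, x) < c₁} ≤ δ_N` for all `N, s, x`
(`floorFixed_homogeneous_of_static`). -/
theorem floorFixed_homogeneous_of_hLow :
    ∀ (σ θ₀ : ℝ), σ ≤ 1 / 2 → 0 < θ₀ →
      (∀ (N : ℕ) (c : T3) (r : ℝ), 2 * hsDiameter σ N ≤ r → r < 1 / 4 →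
        posGibbsMeasure (fun _ => (1 : ℝ)) (hsDiameter σ N) (N + 1)
            {x | (∑ i, ({y : T3 | Torus.euclidDist y c < r}).indicator (fun _ => (1 : ℝ)) (x i)) ≤
                ((N : ℝ) + 1) * (4 / 3 * Real.pi * r ^ 3) / 16} ≤
          ENNReal.ofReal (8 * Real.exp (-(Real.log 2 / 16 * (((N : ℝ) + 1) * (4 / 3 * Real.pi * r ^ 3)))))) →
      ∀ (Φ : (N : ℕ) → HardSphereFlow (Torus.geometry (Fin 3)) (hsDiameter σ N) (N + 1)) (γ C : ℝ)
        (φ : ℕ → T3 → ℝ), 0 < γ → γ < 1 / 3 →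
        ((∀ N, Literature.Analysis.FunctionSpaces.Torus.IsSmooth (φ N)) ∧ (∀ N y, 0 ≤ φ N y) ∧
          (∀ N, ∫ y, φ N y = 1) ∧
          (∀ (N : ℕ) y, ((N : ℝ) + 1) ^ (-γ) ≤ Torus.euclidDist y 0 → φ N y = 0) ∧
          (∀ (N : ℕ) y, φ N y ≤ C * ((N : ℝ) + 1) ^ (3 * γ)) ∧
          (∀ (N : ℕ) y, ‖Literature.Analysis.FunctionSpaces.Torus.gradient (φ N) y‖ ≤
            C * ((N : ℝ) + 1) ^ (4 * γ))) →
        ∃ c₁ : ℝ, 0 < c₁ ∧ ∃ δ : ℕ → ℝ, Tendsto (fun N : ℕ => ((N : ℝ) + 1) ^ 2 * δ N) atTop (𝓝 0) ∧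
          ∀ (N : ℕ) (s : ℝ) (x : T3),
            localGibbsLaw σ (fun _ => 1) (fun _ => 0) (fun _ => θ₀) N (Φ N)
                {z | empiricalDensityField ((Φ N).flow s z) (fun y => φ N (y - x)) < c₁} ≤
              ENNReal.ofReal (δ N) :=
  fun _ _ hσ2 hθ hstat Φ _ _ _ hγ hγ1 hadm =>
    floorFixed_homogeneous_of_static hσ2 hθ hstat Φ hγ hγ1 hadm

end Summit.AtomisticToContinuum.HydrodynamicLimit.Theorems.AdiabatCeiling

end
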